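import Literature.Geometry.Lorentzian.ScalarCurvatureIntegrable
import Literature.Geometry.Lorentzian.DecaySymbols
import Literature.Geometry.Lorentzian.MetricNormSqBounds
import Literature.Geometry.Lorentzian.PositiveMassRigidity
import HarnessLib

/-!
# Decay of the curvature on an asymptotically Schwarzschildean end: `K₁₂ = O(r⁻³)`

Schoen–Yau, Comm. Math. Phys. 65 (1979), p. 54 ("By (1.1), we have `Ric(ν) = O(1/r³)`") and
p. 55 ("By (1.1) we have `K₁₂ = O(1/r³)`"): on an end with the expansion (1.1),
`h = (1 + M/2r)⁴ δ + O₂(r⁻²)` (`IsAsymptoticallySchwarzschild e D M 2`), the curvature decays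
like `r⁻³`. This file proves it in the form consumed by Step 3 of the proof of Theorem 1
(`SchoenYau.curvature_integrals_of_stable_minimal`, `SchoenYauStableSurface.lean`: the
hypothesis `|R/2 − Ric(ν,ν)| ≤ Λ' ρ⁻³`, `R/2 − Ric(ν,ν) = K₁₂` being the sectional curvature of
the plane `ν^⊥` in dimension `3`):

* `IsAsymptoticallySchwarzschild.isBigOSmooth_hCoeff_sub_innerSL`,
  `IsAsymptoticallySchwarzschild.isMetricAsymptoticallyFlat` — (1.1) implies Bartnik's decay
  `h − δ = O₂(r⁻¹)` (`(1 + M/2r)⁴ − 1 = O₂(r⁻¹)` by the symbol calculus of `DecaySymbols.lean`);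
* `IsAsymptoticallySchwarzschild.exists_bound_half_scalarCurvature_sub_ricci` — **`K₁₂ = O(r⁻³)`**:
  there are `Λ` and `R₁` with `|R(Φ z)/2 − Ric_{Φ z}(v, v)| ≤ Λ ‖z‖⁻³` for `‖z‖ ≥ R₁` and every
  `h`-unit vector `v` at `Φ z` (`‖Ric‖²_h ≤ K r⁻⁶` by `AFEnd.exists_bound_normSq_ricci`,
  `|Ric(v,v)| ≤ √‖Ric‖²` and `R² ≤ 3‖Ric‖²`).

Everything is proved; no definitions, no named facts.

## References

* R. Schoen, S.-T. Yau, *On the proof of the positive mass conjecture in general relativity*,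
  Comm. Math. Phys. 65 (1979) 45–76, §1 (1.1), §2 pp. 54–55. [SchoenYauPMT1979]
* R. Bartnik, *The mass of an asymptotically flat manifold*, CPAM 39 (1986), Def. 2.1.
-/

noncomputable section

-- instance search on the operator space of metric components (`E3 →L[ℝ] E3 →L[ℝ] ℝ`) is deep
set_option maxSynthPendingDepth 3

open Set Filter Asymptotics Bornology Topology Module
open scoped ContDiff Manifold RealInnerProductSpace

namespace Literature.Geometry.Lorentzian

variable {X : Type} [TopologicalSpace X] [ChartedSpace E3 X] [IsManifold (𝓡 3) ∞ X]
  {e : AFEnd X} {D : InitialDataSet (𝓡 3) X} {M : ℝ}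

/-- **(1.1) makes `h − δ` a smooth symbol of order `−1`**: `h − δ = (h − (1+M/2r)⁴δ) +
((1+M/2r)⁴ − 1)δ` with the first summand `O₂(r⁻²)` by (1.1) (smooth on the exterior region,
`AFEnd.ContDiffOn_hCoeff_holds`) and the second `O₂(r⁻¹)` (`(s+t)⁴ − s⁴` with `s = 1`,
`t = M/2r`, `IsBigOSmooth.add_pow_four_sub_pow_four`). Schoen–Yau 1979, (1.1); Bartnik 1986,
Def. 2.1. [cite: SchoenYauPMT1979, §1 (1.1)] -/
theorem IsAsymptoticallySchwarzschild.isBigOSmooth_hCoeff_sub_innerSL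
    (hAS : IsAsymptoticallySchwarzschild e D M 2) :
    IsBigOSmooth 2 (-1) fun y ↦ AFEnd.hCoeff e D y - (innerSL ℝ : E3 →L[ℝ] E3 →L[ℝ] ℝ) := by
  set δ : E3 →L[ℝ] E3 →L[ℝ] ℝ := (innerSL ℝ : E3 →L[ℝ] E3 →L[ℝ] ℝ) with hδ
  -- the Schwarzschild factor `(1 + M/2r)⁴` is a symbol of order `0`
  have hw4 : IsBigOSmooth 2 0 fun y : E3 ↦ (1 + M / (2 * ‖y‖)) ^ 4 := by
    refine ((isBigOSmooth_const_add_mul_inv_norm (E := E3) 1 (M / 2)).pow 4).congr fun y ↦ ?_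
    ring
  obtain ⟨R₀, hR₀⟩ := hw4.1
  -- `h − (1 + M/2r)⁴ δ ∈ O₂(r⁻²)` by (1.1)
  have hF₁ : IsBigOSmooth 2 (-2) fun y : E3 ↦ AFEnd.hCoeff e D y - (1 + M / (2 * ‖y‖)) ^ 4 • δ := by
    refine ⟨⟨max e.R R₀, ?_⟩, fun m hm ↦ ?_⟩
    · refine ((AFEnd.ContDiffOn_hCoeff_holds e D).mono fun y (hy : max e.R R₀ < ‖y‖) ↦ ?_).sub
        ((hR₀.mono fun y (hy : max e.R R₀ < ‖y‖) ↦ ?_).smul contDiffOn_const)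
      · exact lt_of_le_of_lt (le_max_left _ _) hy
      · exact lt_of_le_of_lt (le_max_right _ _) hy
    · have h := hAS m hm
      refine h.congr_right fun x ↦ ?_
      norm_num
  -- `((1 + M/2r)⁴ − 1) δ ∈ O₂(r⁻¹)`
  have ht : IsBigOSmooth 2 (-1) fun y : E3 ↦ M / 2 * ‖y‖⁻¹ :=
    (isBigOSmooth_inv_norm (E := E3)).const_mul (M / 2)
  have hF₂ : IsBigOSmooth 2 (-1) fun y : E3 ↦ ((1 + M / (2 * ‖y‖)) ^ 4 - 1) • δ := by
    have h := IsBigOSmooth.add_pow_four_sub_pow_four (isBigOSmooth_const (E := E3) 2 (1 : ℝ)) ht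
      (by norm_num)
    refine (h.smul_const δ).congr fun y ↦ ?_
    congr 1
    ring
  refine ((hF₁.mono (by norm_num)).add hF₂).congr fun y ↦ ?_
  simp only [sub_smul, one_smul]
  abel

/-- **(1.1) implies `h − δ = O₂(r⁻¹)`** (Bartnik's asymptotic flatness of order `1` of the
metric, `AFEnd.IsMetricAsymptoticallyFlat e D 1`). Schoen–Yau 1979, (1.1); Bartnik 1986,
Def. 2.1. [cite: SchoenYauPMT1979, §1 (1.1)] -/
theorem IsAsymptoticallySchwarzschild.isMetricAsymptoticallyFlat
    (hAS : IsAsymptoticallySchwarzschild e D M 2) : AFEnd.IsMetricAsymptoticallyFlat e D 1 :=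
  fun _ hm ↦ hAS.isBigOSmooth_hCoeff_sub_innerSL.isBigO hm

/-- `√(K r⁻⁶) = √K · r⁻³` bookkeeping: `‖z‖ ^ (-(2·1+4)) = (‖z‖⁻¹)³ · (‖z‖⁻¹)³`. [folklore] -/
theorem norm_rpow_neg_six_eq (z : E3) (hz : 0 < ‖z‖) :
    ‖z‖ ^ (-(2 * (1 : ℝ) + 4)) = (‖z‖⁻¹ ^ 3) ^ 2 := by
  rw [show (-(2 * (1 : ℝ) + 4)) = -((6 : ℕ) : ℝ) by norm_num, Real.rpow_neg hz.le,
    Real.rpow_natCast]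
  ring

/-- **`K₁₂ = O(r⁻³)` on an asymptotically Schwarzschildean end** (Schoen–Yau 1979, p. 55: "By
(1.1) we have `K₁₂ = O(1/r³)`"; p. 54: "`Ric(ν) = O(1/r³)`"). If `h = (1 + M/2r)⁴δ + O₂(r⁻²)`
in the chart `Φ` of the end `e`, there are `Λ` and `R₁ > R`, `R₁ ≥ 1`, such that for every `z`
with `‖z‖ ≥ R₁` and every `h`-unit vector `v` at `Φ z`,
`|R(Φ z)/2 − Ric_{Φ z}(v, v)| ≤ Λ ‖z‖⁻³` — in dimension `3`, `R/2 − Ric(v, v)` is the sectional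
curvature of the plane `v^⊥`. Proof: `‖Ric‖²_h(Φ z) ≤ K ‖z‖⁻⁶` (`AFEnd.exists_bound_normSq_ricci`
with `h − δ = O₂(r⁻¹)`), `|Ric(v, v)| ≤ √‖Ric‖²_h` (`abs_apply_le_sqrt_normSq_mul`) and
`R² ≤ 3 ‖Ric‖²_h` (`sq_scalarCurvature_le`). [cite: SchoenYauPMT1979, §2, pp. 54–55] -/
theorem IsAsymptoticallySchwarzschild.exists_bound_half_scalarCurvature_sub_ricci
    [D.metric.HasLeviCivita] (hAS : IsAsymptoticallySchwarzschild e D M 2) :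
    ∃ Λ R₁ : ℝ, e.R < R₁ ∧ 1 ≤ R₁ ∧ ∀ z : E3, R₁ ≤ ‖z‖ →
      ∀ v : TangentSpace (𝓡 3) (e.dataChartExt z), D.metric.val (e.dataChartExt z) v v = 1 →
        |D.metric.scalarCurvature (e.dataChartExt z) / 2 -
            D.metric.ricci (e.dataChartExt z) v v| ≤ Λ * ‖z‖⁻¹ ^ 3 := by
  obtain ⟨K, R₁, hR₁, h1, hK⟩ :=
    AFEnd.exists_bound_normSq_ricci e D one_pos hAS.isMetricAsymptoticallyFlat
  have hg : D.metric.IsRiemannian := D.isRiemannian_metric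
  refine ⟨2 * Real.sqrt (max K 0), R₁, hR₁, h1, fun z hz ↦ ?_⟩
  set x := e.dataChartExt z with hx
  intro v hv
  have hzpos : 0 < ‖z‖ := lt_of_lt_of_le (lt_of_lt_of_le e.R_pos hR₁.le) hz
  have hN0 : 0 ≤ D.metric.normSq x (D.metric.ricci x) := D.metric.normSq_nonneg x hg _
  -- `‖Ric‖² ≤ K₊ r⁻⁶`
  have hN : D.metric.normSq x (D.metric.ricci x) ≤ max K 0 * (‖z‖⁻¹ ^ 3) ^ 2 := by
    calc D.metric.normSq x (D.metric.ricci x) ≤ K * ‖z‖ ^ (-(2 * (1 : ℝ) + 4)) := hK z hz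
      _ ≤ max K 0 * ‖z‖ ^ (-(2 * (1 : ℝ) + 4)) :=
          mul_le_mul_of_nonneg_right (le_max_left _ _) (Real.rpow_nonneg hzpos.le _)
      _ = max K 0 * (‖z‖⁻¹ ^ 3) ^ 2 := by rw [norm_rpow_neg_six_eq z hzpos]
  have hsq : Real.sqrt (D.metric.normSq x (D.metric.ricci x)) ≤
      Real.sqrt (max K 0) * ‖z‖⁻¹ ^ 3 := by
    calc Real.sqrt (D.metric.normSq x (D.metric.ricci x))
        ≤ Real.sqrt (max K 0 * (‖z‖⁻¹ ^ 3) ^ 2) := Real.sqrt_le_sqrt hN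
      _ = Real.sqrt (max K 0) * ‖z‖⁻¹ ^ 3 := by
          rw [Real.sqrt_mul (le_max_right _ _), Real.sqrt_sq (by positivity)]
  -- `|Ric(v,v)| ≤ √‖Ric‖²`
  have hRic : |D.metric.ricci x v v| ≤ Real.sqrt (D.metric.normSq x (D.metric.ricci x)) := by
    have h := D.metric.abs_apply_le_sqrt_normSq_mul x hg (D.metric.ricci x) v
    rwa [hv, mul_one] at h
  -- `|R| ≤ √3 √‖Ric‖² ≤ 2 √‖Ric‖²`
  have hS : |D.metric.scalarCurvature x| ≤
      2 * Real.sqrt (D.metric.normSq x (D.metric.ricci x)) := by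
    have h := D.metric.sq_scalarCurvature_le hg x
    rw [finrank_euclideanSpace_fin] at h
    have h4 : D.metric.scalarCurvature x ^ 2 ≤
        (2 * Real.sqrt (D.metric.normSq x (D.metric.ricci x))) ^ 2 := by
      rw [mul_pow, Real.sq_sqrt hN0]
      push_cast at h
      linarith
    rw [← Real.sqrt_sq_eq_abs]
    calc Real.sqrt (D.metric.scalarCurvature x ^ 2)
        ≤ Real.sqrt ((2 * Real.sqrt (D.metric.normSq x (D.metric.ricci x))) ^ 2) :=
          Real.sqrt_le_sqrt h4
      _ = 2 * Real.sqrt (D.metric.normSq x (D.metric.ricci x)) := Real.sqrt_sq (by positivity)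
  -- assemble
  calc |D.metric.scalarCurvature x / 2 - D.metric.ricci x v v|
      ≤ |D.metric.scalarCurvature x / 2| + |D.metric.ricci x v v| := abs_sub _ _
    _ = |D.metric.scalarCurvature x| / 2 + |D.metric.ricci x v v| := by
        rw [abs_div, abs_two]
    _ ≤ Real.sqrt (D.metric.normSq x (D.metric.ricci x)) +
          Real.sqrt (D.metric.normSq x (D.metric.ricci x)) := by
        exact add_le_add (by linarith) hRic
    _ ≤ 2 * (Real.sqrt (max K 0) * ‖z‖⁻¹ ^ 3) := by linarith
    _ = 2 * Real.sqrt (max K 0) * ‖z‖⁻¹ ^ 3 := by ring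

end Literature.Geometry.Lorentzian

end
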